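import Mathlib.Algebra.Ring.Action.Subobjects
import Literature.AnabelianGeometry.SemiGraphs.TemperedAnabelian
import Summits.ABC.IUTFork.LanaStrips
import Summits.ABC.IUTFork.LanaPadicGalois
import HarnessLib

/-!
# L-LANA objects III ter: the reference local datum at a BAD place from a tempered curve datum (LANA §3.8 (a) (b1))

Record-only file (D-0012) of the abc-iut cell (seat abc-iut-c312-4, L-LANA level; CONSUMES layer L3's
curve-level interface `Literature.AnabelianGeometry.SemiGraphs.TemperedCurve` — ruling η of abc-iut-L3-lead:
"THE interface for curve-level consumers"); TAKES NO SIDE on [IUTchIII] Cor. 3.12. LANA §3.8 (a) pp. 20–21: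
"(b1) When `v ∈ V^bad`, [`Π_v`] denotes the tempered fundamental group `π₁^{temp}(X_v)` … there exists a
natural surjective homomorphism `Π_v ↠ G_v`." L3's `TemperedCurve p` prints exactly this: the base field
`K` (a finite extension of `ℚ_p` INSIDE `ℚ̄_p`), the topological group `Π^temp_{X_K}` and its augmentation
`Π^temp_{X_K} → G_{ℚ_p}` with image `G_K = Gal(ℚ̄_p/K)` ([SemiAnbd] §6 p. 69). This file plugs it into
`RefLocalDatum`:

* `K̄_v := ℚ̄_p` (Mathlib `PadicAlgCl p`, with `| · |`), `G_v := G_K ≤ Gal(ℚ̄_p/ℚ_p)` acting on `ℚ̄_p` through the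
  ambient action — valuation-preserving and continuous by `LanaPadicGalois` (restriction to a subgroup),
  `Π_v := X.PiTemp`, and `Π_v ↠ G_v :=` the augmentation co-restricted to its image (`augToGK`, surjective by
  `X.range_aug`) — `RefLocalDatum.ofTemperedCurve X`;
* hence Table 1 at a bad place: `F_v = Π^temp_{X_v} ↷ O^▷_{ℚ̄_p}` through `Π_v ↠ G_K` (`badPlaceFhol`), and the
  geometric tempered fundamental group `Δ^temp_X = ker(aug)` (L3 `TemperedCurve.DeltaTemp`) ACTS TRIVIALLY
  on the Frobenius-like monoid (`deltaTemp_acts_trivially`) — the mono-analytic content is carried by `G_v`.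

As for L3's own printed theorems, nothing here says that `X` IS the `π₁^{temp}` of the curve `X_v` of the
initial Θ-data: that is L3's origin certificate `TemperedOrigin.IsHyperbolicCurveOrigin`, to be threaded by
the consumer. [cite: LANA2026Report, §3.8 (a) pp. 20–21, §3.10 p. 22] [cite: MochizukiSemiAnbd2006, §6 p.69]
NOT here: any judgement.
-/

noncomputable section

namespace Summit.ABC
namespace IUTFork

open scoped NNReal
open Literature.AnabelianGeometry.SemiGraphs

variable {p : ℕ} [Fact p.Prime]

/-- `G_{ℚ_p}` of layer L3 (`GQp p`) IS `LanaPadicGalois.PadicGal p` (both are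
`AlgebraicClosure ℚ_[p] ≃ₐ[ℚ_[p]] AlgebraicClosure ℚ_[p]`). [folklore] -/
theorem gQp_eq_padicGal : GQp p = PadicGal p := rfl

namespace TemperedCurveRef

variable (X : TemperedCurve p)

/-- The augmentation lands in `G_K` ("with image `G_K`", `X.range_aug`). [cite: MochizukiSemiAnbd2006, §6 p.69] -/
theorem aug_mem_GK (g : X.PiTemp) : X.aug g ∈ X.GK := by
  have h : X.aug g ∈ X.aug.toMonoidHom.range := ⟨g, rfl⟩
  rw [X.range_aug] at h
  exact h

/-- The augmentation `Π^temp_{X_K} → G_{ℚ_p}` co-restricted to its image `G_K`: the surjection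
`Π_v ↠ G_v` of LANA §3.8 (a). [cite: LANA2026Report, §3.8 (a) p. 21] -/
def augToGK : X.PiTemp →ₜ* X.GK where
  toFun g := ⟨X.aug g, aug_mem_GK X g⟩
  map_one' := Subtype.ext (map_one X.aug)
  map_mul' g h := Subtype.ext (map_mul X.aug g h)
  continuous_toFun := (map_continuous X.aug).subtype_mk _

/-- `augToGK g = aug g` in `G_{ℚ_p}`. [cite: LANA2026Report, §3.8 (a) p. 21] -/
@[simp] theorem coe_augToGK (g : X.PiTemp) : ((augToGK X g : X.GK) : GQp p) = X.aug g := rfl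

/-- `Π_v ↠ G_v` is surjective. [cite: LANA2026Report, §3.8 (a) p. 21] -/
theorem augToGK_surjective : Function.Surjective (augToGK X) := by
  rintro ⟨σ, hσ⟩
  have hσ' : σ ∈ X.aug.toMonoidHom.range := by rw [X.range_aug]; exact hσ
  obtain ⟨g, hg⟩ := hσ'
  exact ⟨g, Subtype.ext hg⟩

/-- `G_K ≤ Gal(ℚ̄_p/ℚ_p)` preserves `| · |` (restriction of `LanaPadicGalois.isValPreserving_padic`).
[cite: LANA2026Report, §3.5 p. 19] -/
instance isValPreserving_GK : IsValPreserving (padicVal p) X.GK where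
  val_smul h a := IsValPreserving.val_smul (h : PadicGal p) a

end TemperedCurveRef

open TemperedCurveRef in
/-- **§3.8 (a) (b1) over L3's interface**: the reference local datum at a bad place — `K̄_v = ℚ̄_p`, `| · |`,
`G_v = G_K ≤ Gal(ℚ̄_p/ℚ_p)` (Krull topology; isometric continuous action), `Π_v := Π^temp_{X_K}` (tempered),
`Π_v ↠ G_v :=` the augmentation. [cite: LANA2026Report, §3.8 (a) pp. 20–21] -/
@[reducible] def RefLocalDatum.ofTemperedCurve (X : TemperedCurve p) : RefLocalDatum where
  K := PadicAlgCl p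
  Γ₀ := ℝ≥0
  w := padicVal p
  G := X.GK
  P := X.PiTemp
  ρ := augToGK X
  ρ_surjective := augToGK_surjective X

/-- **Table 1 at a bad place**: `F_v = Π^temp_{X_v} ↷ O^▷_{ℚ̄_p}` through `Π_v ↠ G_K`.
[cite: LANA2026Report, §3.10 Table 1 p. 22] -/
def badPlaceFhol (X : TemperedCurve p) : GMData := (RefLocalDatum.ofTemperedCurve X).Fhol

/-- In `F_v`, the geometric tempered fundamental group `Δ^temp_X = ker(Π^temp → G_{ℚ_p})` (L3
`TemperedCurve.DeltaTemp`) acts TRIVIALLY on `O^▷_{ℚ̄_p}` — "the action determined by the natural surjection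
`Π_v ↠ G_v`" sees only `G_v`. [cite: LANA2026Report, §3.10 p. 22] -/
theorem deltaTemp_acts_trivially (X : TemperedCurve p) (g : X.PiTemp) (hg : g ∈ X.DeltaTemp)
    (a : intMonoid (padicVal p)) :
    @HSMul.hSMul _ _ _ (@instHSMul _ _ (RefLocalDatum.ofTemperedCurve X).holAction.toSMul) g a = a := by
  have hg' : X.aug g = 1 := hg
  change (TemperedCurveRef.augToGK X g) • a = a
  have h1 : TemperedCurveRef.augToGK X g = 1 := Subtype.ext (by rw [TemperedCurveRef.coe_augToGK, hg']; rfl)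
  rw [h1, one_smul]

/-- The étale-unit reference at a bad place is the `ℚ_p`-datum restricted to `G_K`: its compact structure
at `H ≤ G_K` is `I^κ_H` computed in `O^{×μ}_{ℚ̄_p}`. [cite: LANA2026Report, Def. 3.9.1 p. 22] -/
theorem ofTemperedCurve_FunitMu_N (X : TemperedCurve p) (H : OpenSubgroup X.GK) :
    (RefLocalDatum.ofTemperedCurve X).FunitMu.N H =
      (kummerStructure (padicVal p) X.GK (H : Subgroup X.GK)).toSubmonoid := rfl

end IUTFork

end Summit.ABC

end
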